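import Mathlib
import Summits.HodgeConjecture.HodgeConjecture.Theses.CurveNetMordellWeil

/-!
# Sketch — crux idea `hodge-module-yoneda-chains` (crux stmt-HodgeConjecture-2782, round 2, ideator 4)

First checkable statement of the line: the **extremal-weight purification lemma** for Yoneda
`Ext` classes in an abelian category carrying an abstract weight structure with Saito/BBD
orthogonality (`Hom(M, N[i]) = 0` whenever `weights(M) ≤ k` and `weights(N) > k - i`).
Instance intended: `C = MHM(ℙ^m)` (M. Saito), `B = IC(R¹π_*ℚ)(q)` (weight `0` after twist),
`A = ℚ^H_{ℙ^m}[m]` (weight `m`), `m = 2q - 1`; a Hodge class of the crux lifts to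
`Ext^m_{MHM(ℙ^m)}(A, B)` and the lemma rewrites it as a sum of CHAINS of `m` one-extensions
through PURE Hodge modules of the intermediate weights `1, …, m-1`.  Mathlib has no mixed Hodge
modules, so the lemma is typed abstractly over `CategoryTheory.Abelian.Ext`; the case `m = 3`
(`q = 2`, fourfolds over `ℙ³`) is spelled out.
-/

open CategoryTheory CategoryTheory.Abelian CategoryTheory.Limits

universe w v u

set_option linter.dupNamespace false

namespace Summit.HodgeConjecture.HodgeConjecture.Cruxes.VerticalSupportMiddle.YonedaChains

section Abstract

variable {C : Type u} [Category.{v} C] [Abelian C] [HasExt.{w} C]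

/-- An abstract **weight structure** on an abelian category with `Ext` groups: predicates
"pure of weight `a`", "of weights `≤ k`", "of weights `> k`", subject to (i) pure objects have the
obvious bounds, (ii) an object of weights `≤ k` and `> k - 1` is pure of weight `k`,
(iii) SAITO/BBD ORTHOGONALITY `Ext^i(M, N) = 0` for `weights(M) ≤ k`, `weights(N) > k - i`,
(iv) WEIGHT TRUNCATION: every object is an extension of an object of weights `> k` by one of
weights `≤ k`.  (Satisfied by `MHM(X)` for every complex variety `X`, M. Saito 1990, and by mixed
`ℓ`-adic perverse sheaves, BBD §5.) -/
structure IsWeightStructure (Pure LE GT : ℤ → C → Prop) : Prop where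
  pure_le : ∀ ⦃a k : ℤ⦄ ⦃X : C⦄, Pure a X → a ≤ k → LE k X
  pure_gt : ∀ ⦃a k : ℤ⦄ ⦃X : C⦄, Pure a X → k < a → GT k X
  pure_of_le_of_gt : ∀ ⦃k : ℤ⦄ ⦃X : C⦄, LE k X → GT (k - 1) X → Pure k X
  le_of_iso : ∀ ⦃k : ℤ⦄ ⦃X Y : C⦄, Nonempty (X ≅ Y) → LE k X → LE k Y
  gt_of_iso : ∀ ⦃k : ℤ⦄ ⦃X Y : C⦄, Nonempty (X ≅ Y) → GT k X → GT k Y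
  orthogonal : ∀ ⦃k : ℤ⦄ ⦃M N : C⦄ (i : ℕ), LE k M → GT (k - i) N →
    ∀ x y : Ext.{w} M N i, x = y
  truncation : ∀ (k : ℤ) (X : C), ∃ S : ShortComplex C,
    S.ShortExact ∧ Nonempty (S.X₂ ≅ X) ∧ LE k S.X₁ ∧ GT k S.X₃

/-- **Extremal purification, length 3** (the `q = 2` case of the line's first lemma).  If `A` is
pure of weight `b + 3` and `B` pure of weight `b`, every class in `Ext³(A, B)` — the extremal
degree allowed by orthogonality — is a finite sum of Yoneda composites
`A → P₂[1] → P₁[2] → B[3]` through PURE objects `P₁`, `P₂` of the intermediate weights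
`b + 1`, `b + 2`.  (Proof on paper: truncate the splice objects by weight; orthogonality kills
everything but the top graded piece at each step.) -/
def ExtremalPurification3 : Prop :=
  ∀ (Pure LE GT : ℤ → C → Prop), IsWeightStructure (C := C) Pure LE GT →
    ∀ ⦃b : ℤ⦄ ⦃A B : C⦄, Pure (b + 3) A → Pure b B →
      ∀ x : Ext.{w} A B 3, x ∈ AddSubgroup.closure
        {y : Ext.{w} A B 3 | ∃ (P₁ P₂ : C) (_ : Pure (b + 1) P₁) (_ : Pure (b + 2) P₂)
            (e₁ : Ext.{w} P₁ B 1) (e₂ : Ext.{w} P₂ P₁ 1) (e₃ : Ext.{w} A P₂ 1),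
            y = e₃.comp (e₂.comp e₁ (rfl : 1 + 1 = 2)) (rfl : 1 + 2 = 3)}

/-- **Support splitting** (abstract form of Saito's strict-support decomposition, used by the
line right after purification): a decomposition `P ≅ P' ⊞ P''` of an intermediate pure object
splits every composite through `P` into the sum of the composites through `P'` and `P''`
(bilinearity of Yoneda composition).  Stated for one intermediate object. -/
def CompositeSplitsAlongBiprod : Prop :=
  ∀ ⦃A P' P'' B : C⦄ (c : BinaryBicone P' P'') (_ : c.IsBilimit)
    (e : Ext.{w} A c.pt 1) (f : Ext.{w} c.pt B 2),
    e.comp f (rfl : 1 + 2 = 3) =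
      (e.comp (Ext.mk₀ c.fst) (add_zero 1)).comp ((Ext.mk₀ c.inl).comp f (zero_add 2)) (rfl : 1 + 2 = 3)
      + (e.comp (Ext.mk₀ c.snd) (add_zero 1)).comp ((Ext.mk₀ c.inr).comp f (zero_add 2)) (rfl : 1 + 2 = 3)

end Abstract

/-! ### Anchor: the crux this line concludes (by name; no proof claimed) -/

/-- The route decl a skeleton of this line must conclude BY NAME. -/
abbrev CruxTarget : Prop :=
  Summit.HodgeConjecture.HodgeConjecture.Theses.CurveNetMordellWeil.VerticalSupportMiddle

end Summit.HodgeConjecture.HodgeConjecture.Cruxes.VerticalSupportMiddle.YonedaChains
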